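import Summits.HodgeConjecture.HodgeConjecture.Theorems.F0P3SpectralPacketAnchors   -- ★ (N) FILE 3i p843028: `exists_anchor_evpAtψ`, `anchorsG`, `anchorsH`, `IsSphericalWith.congr`, `evpAtψ_of_test` (+ ★ `isSphericalWith_comap_eigencharacter`, ★ `isUnitarizable_comap`)
import HarnessLib

/-!
# (N) DEFS, FILE 3i′ — THE (P4) ANCHORS WITH UNITARIZABILITY ASKED POINTWISE, AT THE PACKET IN HAND ONLY (★ 3i `exists_anchor_evpAtψ` ∕ `anchorsG` ∕ `anchorsH` with the kit-wide
# hypothesis «`sph P h` unitarizable for EVERY packet `P`» replaced by «… for THIS packet's local components») (Rogawski §13.7 p. 206; §12.2 pp. 172–174; §4.5; Cartier §IV.1)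

Cell `hodgecm-mathlib` (D-0151), F0∕P3 «U3-mult», crux H413 (`stmt-HodgeConjecture-24833`), route of record `HCCMUnconditional`.  (N) lead pen F0P3a-p01 (g14); P3b desk F0P3b-plan (g17)
OBJECTION P3b-OBJ-1 (2026-09-01 15:43Z): the kit laws (KG3) «every member of every packet of `Π′(G_v)` is admissible AND UNITARIZABLE» ∧ (KG8) «every admissible irreducible lies in some
packet» of BOARD rev. 6∕7 `TupleKitLaws` are jointly UNSATISFIABLE — `E(G)` is the set of ADMISSIBLE irreducibles and Thm. 13.1.1 partitions all of it, so the non-unitarizable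
irreducible principal series `i_G(χ)` (χ off the unitary axis and the reducibility lines, §12.2 p. 172) are (singleton) packets.  Unitarizability is NOT a kit law; it is a property of
the local components of DISCRETE packets, and the only place the junction reads it is the (P4) anchor of ONE discrete packet at ONE unramified place.  ★ 3i asks it kit-wide
(`hunit : ∀ v P h, (sph P h).IsUnitarizable`) although its proof uses it only at `(Π.loc v, hunr)`; THIS FILE re-heads the three ★ 3i theorems with the POINTWISE hypothesis, so that
BOARD rev. 8's spectral rows (KU-G) `∀ Q : SpectralPacketG …, ∀ v h, (sph (Q.fin.loc v) h).IsUnitarizable` ∕ (KU-H) feed (P4) by name.  PROOF LANE: theorems only (0 definitions, no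
instance, no notation, no named fact, no `sorry`); `--supports stmt-HodgeConjecture-24833 --as helper`; never imports a `Cruxes/…/Lines` module.
HONEST LABEL: HC_CM is proved only modulo the printed citations until rung 0 closes; this file proves no printed statement.

CONTENTS.
* §1 `GlobalPacket.exists_anchor_evpAtψ_of_unitarizable (hunit : ∀ h : unr (Π.loc v), (sph (Π.loc v) h).IsUnitarizable)` — ★ 3i `exists_anchor_evpAtψ` line for line.
* §2 `SpectralPacketG.anchorsG_of_unitarizable (hunit : ∀ v h, (sph (Q.fin.loc v) h).IsUnitarizable)` and `SpectralPacketH.anchorsH_of_unitarizable (hunit : ∀ v h,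
  (sph (ρ.imageG.loc v) h).IsUnitarizable)` — the (P4)-G ∕ (P4)-H clauses of the letter at the tuple, shape verbatim.

References: [Rogawski1990] §13.7 p. 206, §12.2 pp. 172–174, §13.1 Thm. 13.1.1 p. 198, p. 199, §4.5 p. 45, §14.2 p. 232; [CartierCorvallis1979] §IV.1 Cor. 4.1.
-/

set_option autoImplicit false
-- the mandated namespace repeats `HodgeConjecture.HodgeConjecture`, as in every `Theorems/*.lean` of this sub-problem
set_option linter.dupNamespace false

noncomputable section

open NumberField IsDedekindDomain MeasureTheory Filter
open scoped Matrix MatrixGroups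

open Literature.NumberTheory Literature.NumberTheory.Automorphic Literature.NumberTheory.Automorphic.UnitaryGroup
open Literature.NumberTheory.Rogawski1990 Literature.NumberTheory.GaloisRepresentations
open Literature.RepresentationTheory.BorelWallach2000 Literature.RepresentationTheory.KonnoKonno2007
open Summit.HodgeConjecture.HodgeConjecture.Cruxes.H413.F0P3InnerFormClassificationV6 (splitForm)
open Summit.HodgeConjecture.HodgeConjecture.Cruxes.H413.F0P3LocalPacketKit
open Summit.HodgeConjecture.HodgeConjecture.Cruxes.H413.F0P3ArchPacketKit
open Summit.HodgeConjecture.HodgeConjecture.Cruxes.H413.F0P3EigencharacterTransport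
open Summit.HodgeConjecture.HodgeConjecture.Cruxes.H413.F0P3ClassTokenChoice (isUnitarizable_comap)

/-! ## §1 The anchor of an unramified place, unitarizability asked at that place only [§13.7 p. 206; §4.5; Cartier §IV.1] -/

namespace Summit.HodgeConjecture.HodgeConjecture.Cruxes.H413.F0P3GlobalPacket.GlobalPacket

variable {L : Type} [Field L] [NumberField L] [IsCMField L] {H : Matrix (Fin 3) (Fin 3) L}
  {𝔩 : ∀ v : HeightOneSpectrum (𝓞 ↥(maximalRealSubfield L)), LocalPacketKit L (splitForm L 3) v}

/-- **THE (P4) ANCHOR AT THE TUPLE, unitarizability asked AT THE PACKET IN HAND**: off `ram Π`, with `ψ_v(K′_v) = K_v` and `ν′_v(K′_v) ≠ 0`, the transport `π_v⁰ ∘ ψ_v` of the unramified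
member of `Π_v` is an admissible, unitarizable, `K′_v`-spherical class of `G′_v` WITH e.v.p. `Π.evpAtψ ψ (ψ_* ν′) v` — modulo (ℓ4) `UnramLaw`, «`sph` admissible» (kit-wide: the members
of `Π′(G_v)` are admissible) and «`sph (Π.loc v)` unitarizable» (THIS packet, THIS place: true for the local components of a DISCRETE packet, §12.2 pp. 172–174 with p. 199).
★ 3i `exists_anchor_evpAtψ` line for line. [cite: Rogawski1990, §13.7 p. 206; §4.5 p. 45; §14.2 p. 232; §12.2 pp. 172–174] [cite: CartierCorvallis1979, §IV.1 Cor. 4.1] -/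
theorem exists_anchor_evpAtψ_of_unitarizable (Pg : GlobalPacket 𝔩)
    (ψ : ∀ v : HeightOneSpectrum (𝓞 ↥(maximalRealSubfield L)), (cmDatum L 3 H).Local v ≃ₜ* (cmDatum L 3 (splitForm L 3)).Local v)
    [∀ v : HeightOneSpectrum (𝓞 ↥(maximalRealSubfield L)), MeasurableSpace ((cmDatum L 3 (splitForm L 3)).Local v)]
    [∀ v : HeightOneSpectrum (𝓞 ↥(maximalRealSubfield L)), BorelSpace ((cmDatum L 3 (splitForm L 3)).Local v)]
    [∀ v : HeightOneSpectrum (𝓞 ↥(maximalRealSubfield L)), MeasurableSpace ((cmDatum L 3 H).Local v)]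
    [∀ v : HeightOneSpectrum (𝓞 ↥(maximalRealSubfield L)), BorelSpace ((cmDatum L 3 H).Local v)]
    (νG' : ∀ v : HeightOneSpectrum (𝓞 ↥(maximalRealSubfield L)), Measure ((cmDatum L 3 H).Local v))
    [∀ v, (νG' v).IsMulLeftInvariant] [∀ v, IsFiniteMeasureOnCompacts (νG' v)]
    (h4 : ∀ v : HeightOneSpectrum (𝓞 ↥(maximalRealSubfield L)), (𝔩 v).UnramLaw)
    (hadm : ∀ (v : HeightOneSpectrum (𝓞 ↥(maximalRealSubfield L))) (P : (𝔩 v).Pkt) (h : (𝔩 v).unr P), ((𝔩 v).sph P h).IsAdmissible)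
    {v : HeightOneSpectrum (𝓞 ↥(maximalRealSubfield L))}
    (hunit : ∀ h : (𝔩 v).unr (Pg.loc v), ((𝔩 v).sph (Pg.loc v) h).IsUnitarizable)
    (hψK : (cmLocalIntegralLevel L 3 H v).map (ψ v : (cmDatum L 3 H).Local v →* (cmDatum L 3 (splitForm L 3)).Local v) =
      cmLocalIntegralLevel L 3 (splitForm L 3) v)
    (hμK : (νG' v).real (cmLocalIntegralLevel L 3 H v : Set ((cmDatum L 3 H).Local v)) ≠ 0) (hram : v ∉ Pg.ramFinset) :
    ∃ π : IrrClass ((cmDatum L 3 H).Local v), π.IsAdmissible ∧ π.IsUnitarizable ∧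
      π.IsSphericalWith (cmLocalIntegralLevel L 3 H v) (νG' v) (Pg.evpAtψ ψ (fun w => (νG' w).map (ψ w)) v) := by
  have hunr : (𝔩 v).unr (Pg.loc v) := Pg.unr_of_not_mem_ramFinset hram
  set c := (𝔩 v).sph (Pg.loc v) hunr with hc
  have hsph : c.IsSpherical ((cmLocalIntegralLevel L 3 H v).map (ψ v : (cmDatum L 3 H).Local v →* (cmDatum L 3 (splitForm L 3)).Local v)) := by
    rw [hψK]
    exact ((h4 v) (Pg.loc v) hunr).2.1
  refine ⟨IrrClass.comap (ψ v) c, (hadm v _ hunr).comap (ψ v), isUnitarizable_comap (ψ v) (hunit hunr), ?_⟩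
  have hsw := isSphericalWith_comap_eigencharacter (ψ v) (hadm v _ hunr) (isCompact_isOpen_cmLocalIntegralLevel L 3 H v).2
    (isCompact_isOpen_cmLocalIntegralLevel L 3 H v).1 (νG' v) hμK hsph
  refine hsw.congr fun f hf hK => ?_
  rw [Pg.evpAtψ_of_test ψ _ ⟨hf, hK⟩, Pg.evpAt_of_unr_eq_eigencharacter v _ hunr, hψK]

end Summit.HodgeConjecture.HodgeConjecture.Cruxes.H413.F0P3GlobalPacket.GlobalPacket

/-! ## §2 The two (P4) clauses of the letter at the tuple, unitarizability asked at the discrete packet only [§13.7 p. 206] -/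

namespace Summit.HodgeConjecture.HodgeConjecture.Cruxes.H413.F0P3SpectralPacket

open Summit.HodgeConjecture.HodgeConjecture.Cruxes.H413.F0P3GlobalPacket

variable {L : Type} [Field L] [NumberField L] [IsCMField L] {H : Matrix (Fin 3) (Fin 3) L}
  {𝔩 : ∀ v : HeightOneSpectrum (𝓞 ↥(maximalRealSubfield L)), LocalPacketKit L (splitForm L 3) v} {𝔞 : ArchPacketKit} {𝔞H : ArchPacketKitH 𝔞}
  {μ : Measure (adelicGroupData (↥(maximalRealSubfield L)) L (IsCMField.complexConj L) 3 (splitForm L 3)).automorphicQuotient}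
  [SMulInvariantMeasure (adelicGroupData (↥(maximalRealSubfield L)) L (IsCMField.complexConj L) 3 (splitForm L 3)).Adelic
    (adelicGroupData (↥(maximalRealSubfield L)) L (IsCMField.complexConj L) 3 (splitForm L 3)).automorphicQuotient μ]
  {DiscH : GlobalPacketH 𝔩 → 𝔞H.PktInfH → Prop}
  [∀ v : HeightOneSpectrum (𝓞 ↥(maximalRealSubfield L)), MeasurableSpace ((cmDatum L 3 (splitForm L 3)).Local v)]
  [∀ v : HeightOneSpectrum (𝓞 ↥(maximalRealSubfield L)), BorelSpace ((cmDatum L 3 (splitForm L 3)).Local v)]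
  [∀ v : HeightOneSpectrum (𝓞 ↥(maximalRealSubfield L)), MeasurableSpace ((cmDatum L 3 H).Local v)]
  [∀ v : HeightOneSpectrum (𝓞 ↥(maximalRealSubfield L)), BorelSpace ((cmDatum L 3 H).Local v)]
  {νG' : ∀ v : HeightOneSpectrum (𝓞 ↥(maximalRealSubfield L)), Measure ((cmDatum L 3 H).Local v)}
  [∀ v, (νG' v).IsMulLeftInvariant] [∀ v, IsFiniteMeasureOnCompacts (νG' v)]

/-- **(P4)-G AT THE TUPLE, unitarizability asked at the discrete packet only**: for a discrete packet `Q` whose local components' unramified members are unitarizable (BOARD rev. 8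
(KU-G), print §12.2 pp. 172–174 with p. 199) and every `v ∉ S₀ ∪ ramG Q`, there is an admissible unitarizable class of `G′_v`, `K′_v`-spherical WITH e.v.p. `evpG Q v` — the letter's
clause verbatim (★ 3i `anchorsG` with the kit-wide `hunit` replaced). [cite: Rogawski1990, §13.7 p. 206; §4.5 p. 45; §12.2 pp. 172–174] [cite: CartierCorvallis1979, §IV.1 Cor. 4.1] -/
theorem SpectralPacketG.anchorsG_of_unitarizable (Q : SpectralPacketG 𝔩 𝔞 μ)
    (ψ : ∀ v : HeightOneSpectrum (𝓞 ↥(maximalRealSubfield L)), (cmDatum L 3 H).Local v ≃ₜ* (cmDatum L 3 (splitForm L 3)).Local v)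
    (h4 : ∀ v : HeightOneSpectrum (𝓞 ↥(maximalRealSubfield L)), (𝔩 v).UnramLaw)
    (hadm : ∀ (v : HeightOneSpectrum (𝓞 ↥(maximalRealSubfield L))) (P : (𝔩 v).Pkt) (h : (𝔩 v).unr P), ((𝔩 v).sph P h).IsAdmissible)
    (hunit : ∀ (v : HeightOneSpectrum (𝓞 ↥(maximalRealSubfield L))) (h : (𝔩 v).unr (Q.fin.loc v)), ((𝔩 v).sph (Q.fin.loc v) h).IsUnitarizable)
    (S₀ : Finset (HeightOneSpectrum (𝓞 ↥(maximalRealSubfield L))))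
    (hψK : ∀ v ∉ S₀, (cmLocalIntegralLevel L 3 H v).map (ψ v : (cmDatum L 3 H).Local v →* (cmDatum L 3 (splitForm L 3)).Local v) =
      cmLocalIntegralLevel L 3 (splitForm L 3) v)
    (hμK : ∀ v : HeightOneSpectrum (𝓞 ↥(maximalRealSubfield L)), (νG' v).real (cmLocalIntegralLevel L 3 H v : Set ((cmDatum L 3 H).Local v)) ≠ 0) (v : HeightOneSpectrum (𝓞 ↥(maximalRealSubfield L))) (hv : v ∉ S₀) (hram : v ∉ Q.fin.ramFinset) :
    ∃ π : IrrClass ((cmDatum L 3 H).Local v), π.IsAdmissible ∧ π.IsUnitarizable ∧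
      π.IsSphericalWith (cmLocalIntegralLevel L 3 H v) (νG' v) (Q.evpGψ ψ (fun w => (νG' w).map (ψ w)) v) :=
  Q.fin.exists_anchor_evpAtψ_of_unitarizable ψ νG' h4 hadm (hunit v) (hψK v hv) (hμK v) hram

/-- **(P4)-H AT THE TUPLE, unitarizability asked at the discrete packet only**: the same for a discrete `H`-packet `ρ` off `S₀ ∪ ramH ρ`, the anchor being the transported unramified
member of `Π(ρ)_v = ξ_H(ρ_v)` (`ρ.imageG`), under (KU-H) «`sph (ξ_H ρ_v)` unitarizable» (print §12.1–12.2, Prop. 13.1.2). [cite: Rogawski1990, §13.7 p. 206; §13.3 Thm. 13.3.4 p. 202; §12.2 pp. 172–174] [cite: CartierCorvallis1979, §IV.1 Cor. 4.1] -/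
theorem SpectralPacketH.anchorsH_of_unitarizable (ρ : SpectralPacketH 𝔩 𝔞 𝔞H DiscH)
    (ψ : ∀ v : HeightOneSpectrum (𝓞 ↥(maximalRealSubfield L)), (cmDatum L 3 H).Local v ≃ₜ* (cmDatum L 3 (splitForm L 3)).Local v)
    (h4 : ∀ v : HeightOneSpectrum (𝓞 ↥(maximalRealSubfield L)), (𝔩 v).UnramLaw)
    (hadm : ∀ (v : HeightOneSpectrum (𝓞 ↥(maximalRealSubfield L))) (P : (𝔩 v).Pkt) (h : (𝔩 v).unr P), ((𝔩 v).sph P h).IsAdmissible)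
    (hunit : ∀ (v : HeightOneSpectrum (𝓞 ↥(maximalRealSubfield L))) (h : (𝔩 v).unr (ρ.imageG.loc v)), ((𝔩 v).sph (ρ.imageG.loc v) h).IsUnitarizable)
    (S₀ : Finset (HeightOneSpectrum (𝓞 ↥(maximalRealSubfield L))))
    (hψK : ∀ v ∉ S₀, (cmLocalIntegralLevel L 3 H v).map (ψ v : (cmDatum L 3 H).Local v →* (cmDatum L 3 (splitForm L 3)).Local v) =
      cmLocalIntegralLevel L 3 (splitForm L 3) v)
    (hμK : ∀ v : HeightOneSpectrum (𝓞 ↥(maximalRealSubfield L)), (νG' v).real (cmLocalIntegralLevel L 3 H v : Set ((cmDatum L 3 H).Local v)) ≠ 0) (v : HeightOneSpectrum (𝓞 ↥(maximalRealSubfield L))) (hv : v ∉ S₀) (hram : v ∉ ρ.ramFinsetH) :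
    ∃ π : IrrClass ((cmDatum L 3 H).Local v), π.IsAdmissible ∧ π.IsUnitarizable ∧
      π.IsSphericalWith (cmLocalIntegralLevel L 3 H v) (νG' v) (ρ.evpHψ ψ (fun w => (νG' w).map (ψ w)) v) :=
  ρ.imageG.exists_anchor_evpAtψ_of_unitarizable ψ νG' h4 hadm (hunit v) (hψK v hv) (hμK v) hram

end Summit.HodgeConjecture.HodgeConjecture.Cruxes.H413.F0P3SpectralPacket

end
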